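import Summits.QuantumFields.BalabanUV.T4Continuum.Support.NE3SmoothRightInverseW
import Summits.QuantumFields.BalabanUV.T4Continuum.Support.NE3CovariantLineSumsL2
import Summits.QuantumFields.BalabanUV.T4Continuum.Support.NE3BlockLineAverage
import Summits.QuantumFields.BalabanUV.T4Continuum.Support.AveragingDeficitCounting
import HarnessLib

/-!
# T⁴ programme, node NE3 — route Π, row Π-R (curved step), file Π-R-W6b⁰: THE SOLVE LETTERS IN THREE NORMS —
# `(1 + K)⁻¹` on the coarse torus is bounded in sup, ℓ¹ and ℓ² by `1∕(1 − θ_loc)`, `θ_loc = thetaLoc(d,L)·(L^{k+1})²·x`, k-FREE, N-FREE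

NE3 (node U1b) formalisation swarm, leaf seat `b2b-balaban-t4-ne3-formalise-leaf-01` (gen 8); row Π-R-W (FINDING F-ne3leaf01g8-1,
`HOME/CLAIMS.log` 2026-08-20 ≈23:04Z; split of the letters with leaf-02-g8, journal 2026-08-21 ≈01:14Z).  W5 (`NE3SmoothRightInverseW`) built the
exact right inverse `rightInvW … φ = hatInvW L k W Φ`, `Φ = ext((1+K)⁻¹(res φ))`, and bounded the solve in SUP (`norm_solveW_le`).  The ℓ¹∕ℓ² letters
(R1)–(R4) of ruling ρ-g25-1 (2) need the solve in ℓ¹ and ℓ² as well.  THE POINT: W4c's crux is LOCAL — `‖(KΦ)(z,κ)‖ ≤ cruxC·ε·sup{‖Φ(z',κ')‖ :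
|z' − z|₁ ≤ nbRad + d}` (`NE3QbarIterCovLift.norm_QbarIter_covLift_sub_le`) — so by Schur∕multiplicity `K` is bounded in ℓ¹(torus) and ℓ²(torus) by
`θ_loc := thetaLoc·ε`, `thetaLoc = cruxC·(1 + d·(2(nbRad+d)+1)^d)`, and `Φ + KΦ = res φ` (`solveW_eq`) gives `‖Φ‖ ≤ ‖φ‖∕(1 − θ_loc)` in each norm
(ℓ²: Minkowski, C2's `NE3CovariantLineSumsL2.sqrt_l2sq_add_le`).  Also here, for the letter files: the ℓ¹-BALL bookkeeping (`l1Ball`, its cardinal,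
the torus MULTIPLICITY identity `Σ_{z∈periodBox N} Σ_{t∈l1Ball R} g(z+t) = #l1Ball·Σ g`), and local sups.

CONTENT ([folklore]; 0 sorry; DATA defs `l1Ball`, `tl1`, `tl2`, `thetaLoc` — explicit): §1 balls and multiplicity; §2 the torus functionals and their
`periodBox` forms; §3 `K` in ℓ¹ and ℓ²; §4 the three solve letters **`dirL1_solve_le`**, **`dirSq_solve_le`**, `norm_solve_le` (+ `cruxC_le_thetaLoc`).

HONEST FRAMING.  Kinematics of OUR objects; constants explicit and crude; the letters (R1)–(R4),(R6′) themselves are the next files; nothing about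
minimisers; (P♮)_W, T-E_w and **NE3 are NOT proved**; spine PROVED 0∕9; finite T⁴ rung (B)+1 — NOT infinite volume, NOT mass gap, NOT `BetaPertH`,
NOT Clay.  PLACEMENT: `Summits/QuantumFields/BalabanUV/`.  HONEST DEPENDENCY (cell page 1): continuum YM on T⁴ ⇐ BetaPertH ∧ nine spine estimates
(0/9 proved); BetaPertH ⇐ (D1) ∧ (D4) ∧ CAP+tail; G-an2-4 gates asym, D1 and NE2/3/4.
-/

set_option autoImplicit false

open scoped BigOperators Matrix.Norms.L2Operator
open Finset

namespace Summit.QuantumFields.BalabanUV.T4Continuum.NE3RightInverseSolveLetters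

open Literature.MathematicalPhysics.QuantumFieldTheory.Balaban1983to89
open B7Prop1Explicit B7Prop2Explicit
open T4AveragingDeficitWall (IsUnitaryCfg IsSkewDir SmallField dirSq dirL1 box)
open T4AveragingDeficitWallBoundary (periodBox sum_periodBox_shift)
open AveragingDeficitPeriodicCounting (IsPeriodicDir)
open AveragingDeficitMultiLevelPrep (cavgIter LevelSmall)
open AveragingDeficitTorusChart (TDir extDir resDir redN redN_boxVec isPeriodicDir_extDir)
open AveragingDeficitTwoLevelPrep (skewSub mem_skewSub)
open AveragingDeficitCounting (card_box_eq mem_box_iff)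
open AveragingDeficitLiftDefectSum (natAbs_le_l1)
open BlockAverageVaryHolo (nbRad)
open NE3TangentCovariantTower (QbarIter)
open NE3BlockLineAverage (sum_univ_boxVec)
open NE3CovariantLineSumsL2 (l2sq l2sq_nonneg sqrt_l2sq_add_le)
open NE3CovariantLift (covLift)
open NE3QbarIterCovLiftPrep (cruxC liftC_nonneg regC_nonneg rhoC_nonneg)
open NE3QbarIterCovLift (norm_QbarIter_covLift_sub_le)
open NE3SmoothRightInverseW (straightDefect straightDefect_apply straightDefectSkew solveW solveW_eq resSkew coe_resSkew norm_solveW_le)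

noncomputable section

variable {d : ℕ} {n : Type*} [Fintype n] [DecidableEq n]

/-! ## §1 ℓ¹-balls on the coarse lattice and the torus multiplicity identity -/

/-- THE ℓ¹-BALL of radius `R` about `0` (a finset: the sup-box filtered). [folklore] -/
def l1Ball (R : ℕ) : Finset (Site d) := (box R 0).filter fun t => l1 t ≤ R

omit [Fintype n] [DecidableEq n] in
/-- Membership: `t ∈ l1Ball R ↔ |t|₁ ≤ R`. [folklore] -/
theorem mem_l1Ball {R : ℕ} {t : Site d} : t ∈ l1Ball R ↔ l1 t ≤ R := by
  unfold l1Ball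
  rw [Finset.mem_filter, and_iff_right_iff_imp]
  intro ht
  rw [mem_box_iff]
  intro κ
  rw [Pi.zero_apply, sub_zero, ← Int.natCast_natAbs]
  exact_mod_cast (natAbs_le_l1 t κ).trans ht

omit [Fintype n] [DecidableEq n] in
/-- `0 ∈ l1Ball R`. [folklore] -/
theorem zero_mem_l1Ball (R : ℕ) : (0 : Site d) ∈ l1Ball R := by
  rw [mem_l1Ball]; unfold l1; simp

omit [Fintype n] [DecidableEq n] in
/-- `#l1Ball R ≤ (2R+1)^d`. [folklore] -/
theorem card_l1Ball_le (R : ℕ) : ((l1Ball R : Finset (Site d))).card ≤ (2 * R + 1) ^ d := by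
  unfold l1Ball
  exact (Finset.card_filter_le _ _).trans (by rw [card_box_eq])

omit [Fintype n] [DecidableEq n] in
/-- … in `ℝ`, in the form the letters use: `d·#l1Ball R ≤ 1 + d·(2R+1)^d`. [folklore] -/
theorem d_mul_card_l1Ball_le (R : ℕ) : (d : ℝ) * ((l1Ball R : Finset (Site d))).card ≤ 1 + (d : ℝ) * (2 * (R : ℝ) + 1) ^ d := by
  have h : (((l1Ball R : Finset (Site d))).card : ℝ) ≤ (2 * (R : ℝ) + 1) ^ d := by exact_mod_cast card_l1Ball_le (d := d) R
  nlinarith [mul_le_mul_of_nonneg_left h (Nat.cast_nonneg d)]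

omit [Fintype n] [DecidableEq n] in
/-- **TORUS MULTIPLICITY**: for an `N`-periodic `g`, `Σ_{z∈periodBox N} Σ_{t∈l1Ball R} g(z+t) = #l1Ball R · Σ_{z∈periodBox N} g z`. [folklore] -/
theorem sum_periodBox_sum_l1Ball {N : ℕ} (hN : 1 ≤ N) {g : Site d → ℝ} (hg : ∀ (x : Site d) (κ : Fin d), g (x + (N : ℤ) • e κ) = g x) (R : ℕ) :
    ∑ z ∈ periodBox (d := d) N, ∑ t ∈ l1Ball R, g (z + t) = ((l1Ball R : Finset (Site d))).card * ∑ z ∈ periodBox (d := d) N, g z := by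
  rw [Finset.sum_comm]
  simp_rw [sum_periodBox_shift N hN hg]
  rw [Finset.sum_const, nsmul_eq_mul]

/-- **LOCAL SUPS, ℓ¹ FORM**: `‖Φ z' κ'‖ ≤ Σ_{t∈l1Ball R} Σ_κ ‖Φ(z+t) κ‖` whenever `|z' − z|₁ ≤ R`. [folklore] -/
theorem norm_le_locL1 (Φ : Site d → Fin d → Matrix n n ℂ) (z : Site d) {R : ℕ} {z' : Site d} (κ' : Fin d) (h : l1 (z' - z) ≤ R) :
    ‖Φ z' κ'‖ ≤ ∑ t ∈ l1Ball R, ∑ κ : Fin d, ‖Φ (z + t) κ‖ := by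
  have ht : z' - z ∈ (l1Ball R : Finset (Site d)) := mem_l1Ball.mpr h
  calc ‖Φ z' κ'‖ = ‖Φ (z + (z' - z)) κ'‖ := by rw [add_sub_cancel]
    _ ≤ ∑ κ : Fin d, ‖Φ (z + (z' - z)) κ‖ := Finset.single_le_sum (f := fun κ => ‖Φ (z + (z' - z)) κ‖) (fun _ _ => norm_nonneg _) (Finset.mem_univ κ')
    _ ≤ ∑ t ∈ l1Ball R, ∑ κ : Fin d, ‖Φ (z + t) κ‖ :=
        Finset.single_le_sum (f := fun t => ∑ κ : Fin d, ‖Φ (z + t) κ‖) (fun _ _ => Finset.sum_nonneg fun _ _ => norm_nonneg _) ht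

/-- **LOCAL SUPS, ℓ² FORM**: `‖Φ z' κ'‖ ≤ √(Σ_{t∈l1Ball R} Σ_κ ‖Φ(z+t) κ‖²)` whenever `|z' − z|₁ ≤ R`. [folklore] -/
theorem norm_le_locL2 (Φ : Site d → Fin d → Matrix n n ℂ) (z : Site d) {R : ℕ} {z' : Site d} (κ' : Fin d) (h : l1 (z' - z) ≤ R) :
    ‖Φ z' κ'‖ ≤ Real.sqrt (∑ t ∈ l1Ball R, ∑ κ : Fin d, ‖Φ (z + t) κ‖ ^ 2) := by
  have ht : z' - z ∈ (l1Ball R : Finset (Site d)) := mem_l1Ball.mpr h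
  refine Real.le_sqrt_of_sq_le ?_
  calc ‖Φ z' κ'‖ ^ 2 = ‖Φ (z + (z' - z)) κ'‖ ^ 2 := by rw [add_sub_cancel]
    _ ≤ ∑ κ : Fin d, ‖Φ (z + (z' - z)) κ‖ ^ 2 :=
        Finset.single_le_sum (f := fun κ => ‖Φ (z + (z' - z)) κ‖ ^ 2) (fun _ _ => sq_nonneg _) (Finset.mem_univ κ')
    _ ≤ ∑ t ∈ l1Ball R, ∑ κ : Fin d, ‖Φ (z + t) κ‖ ^ 2 :=
        Finset.single_le_sum (f := fun t => ∑ κ : Fin d, ‖Φ (z + t) κ‖ ^ 2) (fun _ _ => Finset.sum_nonneg fun _ _ => sq_nonneg _) ht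

/-! ## §2 The torus functionals `tl1`, `tl2` and their `periodBox` forms -/

/-- THE TORUS ℓ¹ FUNCTIONAL `tl1 ψ = Σ_r Σ_κ ‖ψ r κ‖`. [folklore] -/
def tl1 (N : ℕ) (ψ : TDir d n N) : ℝ := ∑ r : Fin d → Fin N, ∑ κ : Fin d, ‖ψ r κ‖

/-- THE TORUS ℓ² FUNCTIONAL `tl2 ψ = Σ_r Σ_κ ‖ψ r κ‖²`. [folklore] -/
def tl2 (N : ℕ) (ψ : TDir d n N) : ℝ := ∑ r : Fin d → Fin N, ∑ κ : Fin d, ‖ψ r κ‖ ^ 2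

/-- `0 ≤ tl1`. [folklore] -/
theorem tl1_nonneg (N : ℕ) (ψ : TDir d n N) : 0 ≤ tl1 N ψ := by unfold tl1; positivity

/-- `0 ≤ tl2`. [folklore] -/
theorem tl2_nonneg (N : ℕ) (ψ : TDir d n N) : 0 ≤ tl2 N ψ := by unfold tl2; positivity

/-- `dirL1 φ (periodBox N) = tl1 (res φ)` (no periodicity needed). [folklore] -/
theorem dirL1_periodBox_eq_tl1 (N : ℕ) (φ : Site d → Fin d → Matrix n n ℂ) : dirL1 φ (periodBox (d := d) N) = tl1 N (resDir N φ) := by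
  unfold dirL1 tl1 resDir; rw [← sum_univ_boxVec]

/-- `dirSq φ (periodBox N) = tl2 (res φ)`. [folklore] -/
theorem dirSq_periodBox_eq_tl2 (N : ℕ) (φ : Site d → Fin d → Matrix n n ℂ) : dirSq φ (periodBox (d := d) N) = tl2 N (resDir N φ) := by
  unfold dirSq tl2 resDir; rw [← sum_univ_boxVec]

/-- `dirL1 (ext ψ) (periodBox N) = tl1 ψ`. [folklore] -/
theorem dirL1_extDir (N : ℕ) [NeZero N] (ψ : TDir d n N) : dirL1 (extDir N ψ) (periodBox (d := d) N) = tl1 N ψ := by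
  rw [dirL1_periodBox_eq_tl1]; unfold tl1 resDir extDir; simp only [redN_boxVec]

/-- `dirSq (ext ψ) (periodBox N) = tl2 ψ`. [folklore] -/
theorem dirSq_extDir (N : ℕ) [NeZero N] (ψ : TDir d n N) : dirSq (extDir N ψ) (periodBox (d := d) N) = tl2 N ψ := by
  rw [dirSq_periodBox_eq_tl2]; unfold tl2 resDir extDir; simp only [redN_boxVec]

/-- `l2sq (periodBox N) (ext ψ) = tl2 ψ` (C2's functional). [folklore] -/
theorem l2sq_extDir (N : ℕ) [NeZero N] (ψ : TDir d n N) : l2sq (periodBox (d := d) N) (extDir N ψ) = tl2 N ψ :=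
  dirSq_extDir N ψ

/-! ## §3 The straight defect `K` in ℓ¹(torus) and ℓ²(torus) -/

/-- THE LOCAL CONTRACTION CONSTANT: `thetaLoc = cruxC·(1 + d·(2(nbRad + d) + 1)^d)` (`≥ cruxC`; multiplicity of W4c's ℓ¹-radius `nbRad + d`).
[folklore] -/
def thetaLoc (d L : ℕ) : ℝ := cruxC d L * (1 + (d : ℝ) * (2 * (((nbRad d L + d : ℕ) : ℝ)) + 1) ^ d)

/-- `0 ≤ cruxC`. [folklore] -/
theorem cruxC_nonneg (d L : ℕ) : 0 ≤ cruxC d L := by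
  unfold cruxC; have := liftC_nonneg d; have := regC_nonneg d L; have := rhoC_nonneg d L; positivity

/-- `cruxC ≤ thetaLoc` — the sup binder of W5 is dominated by the local one. [folklore] -/
theorem cruxC_le_thetaLoc (d L : ℕ) : cruxC d L ≤ thetaLoc d L := by
  unfold thetaLoc
  have hc := cruxC_nonneg d L
  have h1 : (1 : ℝ) ≤ 1 + (d : ℝ) * (2 * (((nbRad d L + d : ℕ) : ℝ)) + 1) ^ d := by
    have : (0 : ℝ) ≤ (d : ℝ) * (2 * (((nbRad d L + d : ℕ) : ℝ)) + 1) ^ d := by positivity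
    linarith
  nlinarith

/-- `0 ≤ thetaLoc`. [folklore] -/
theorem thetaLoc_nonneg (d L : ℕ) : 0 ≤ thetaLoc d L := (cruxC_nonneg d L).trans (cruxC_le_thetaLoc d L)

/-- The multiplicity factors against `thetaLoc`: `cruxC·(d·#l1Ball(nbRad+d)) ≤ thetaLoc` and its square form. [folklore] -/
theorem cruxC_mul_card_le (d L : ℕ) :
    cruxC d L * ((d : ℝ) * ((l1Ball (nbRad d L + d) : Finset (Site d))).card) ≤ thetaLoc d L
    ∧ cruxC d L ^ 2 * ((d : ℝ) * ((l1Ball (nbRad d L + d) : Finset (Site d))).card) ≤ thetaLoc d L ^ 2 := by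
  have hc := cruxC_nonneg d L
  have hm := d_mul_card_l1Ball_le (d := d) (nbRad d L + d)
  push_cast at hm
  have hm0 : (0 : ℝ) ≤ (d : ℝ) * ((l1Ball (nbRad d L + d) : Finset (Site d))).card := by positivity
  have hB1 : (1 : ℝ) ≤ 1 + (d : ℝ) * (2 * (((nbRad d L + d : ℕ) : ℝ)) + 1) ^ d := by
    have : (0 : ℝ) ≤ (d : ℝ) * (2 * (((nbRad d L + d : ℕ) : ℝ)) + 1) ^ d := by positivity
    linarith
  have hm' : (d : ℝ) * ((l1Ball (nbRad d L + d) : Finset (Site d))).card ≤ 1 + (d : ℝ) * (2 * (((nbRad d L + d : ℕ) : ℝ)) + 1) ^ d := by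
    push_cast; exact hm
  refine ⟨?_, ?_⟩
  · unfold thetaLoc; exact mul_le_mul_of_nonneg_left hm' hc
  · unfold thetaLoc
    rw [mul_pow]
    refine mul_le_mul_of_nonneg_left (hm'.trans ?_) (sq_nonneg _)
    nlinarith

section Operator

variable [Nonempty n] {L : ℕ} (hL : 2 ≤ L) (k : ℕ) {W : Site d → Fin d → (Matrix n n ℂ)ˣ} {x : ℝ} (hWu : IsUnitaryCfg W) (hx : 0 ≤ x)
  (hs : LevelSmall d L k x) (hWx : SmallField W x) (N : ℕ) [NeZero N]

/-- **`K` IN ℓ¹(TORUS)**: `tl1 (K ψ) ≤ thetaLoc·ε · tl1 ψ`, `ε = (L^{k+1})²·x`. [folklore] -/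
theorem tl1_straightDefect_le (ψ : TDir d n N) :
    tl1 N (straightDefect hL k hWu hx hs hWx N ψ) ≤ thetaLoc d L * (((L : ℝ) ^ (k + 1)) ^ 2 * x) * tl1 N ψ := by
  have hN1 : 1 ≤ N := Nat.one_le_iff_ne_zero.mpr (NeZero.ne N)
  set ε : ℝ := ((L : ℝ) ^ (k + 1)) ^ 2 * x with hε
  have hε0 : 0 ≤ ε := by rw [hε]; positivity
  set Φ : Site d → Fin d → Matrix n n ℂ := extDir N ψ with hΦ
  set R : ℕ := nbRad d L + d with hR
  -- the local ℓ¹ sups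
  set sL : Site d → ℝ := fun z => ∑ t ∈ l1Ball R, ∑ κ : Fin d, ‖Φ (z + t) κ‖ with hsL
  have hsL0 : ∀ z, 0 ≤ sL z := fun z => Finset.sum_nonneg fun _ _ => Finset.sum_nonneg fun _ _ => norm_nonneg _
  have hpt : ∀ (r : Fin d → Fin N) (κ : Fin d), ‖straightDefect hL k hWu hx hs hWx N ψ r κ‖ ≤ cruxC d L * ε * sL (boxVec N r) := by
    intro r κ
    rw [straightDefect_apply]
    have hψ : ψ r κ = Φ (boxVec N r) κ := by rw [hΦ]; unfold extDir; rw [redN_boxVec]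
    rw [hψ]
    exact norm_QbarIter_covLift_sub_le hL k hWu hx hs hWx Φ (boxVec N r) κ (hsL0 _) fun z' κ' hz' => norm_le_locL1 Φ _ κ' hz'
  -- sum, re-index to the period box, multiplicity
  have hper : ∀ (z : Site d) (τ : Fin d), (∑ κ : Fin d, ‖Φ (z + (N : ℤ) • e τ) κ‖) = ∑ κ : Fin d, ‖Φ z κ‖ := by
    intro z τ
    simp only [hΦ, AveragingDeficitTorusChart.extDir_add_smul]
  have hmult : ∑ z ∈ periodBox (d := d) N, sL z = ((l1Ball R : Finset (Site d))).card * ∑ z ∈ periodBox (d := d) N, ∑ κ : Fin d, ‖Φ z κ‖ := by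
    have key := sum_periodBox_sum_l1Ball (g := fun w => ∑ κ : Fin d, ‖Φ w κ‖) hN1 hper R
    beta_reduce at key
    rw [hsL]; beta_reduce; exact key
  calc tl1 N (straightDefect hL k hWu hx hs hWx N ψ)
      ≤ ∑ r : Fin d → Fin N, ∑ _κ : Fin d, cruxC d L * ε * sL (boxVec N r) := Finset.sum_le_sum fun r _ => Finset.sum_le_sum fun κ _ => hpt r κ
    _ = (d : ℝ) * (cruxC d L * ε) * ∑ z ∈ periodBox (d := d) N, sL z := by
        rw [← sum_univ_boxVec, Finset.mul_sum]
        refine Finset.sum_congr rfl fun r _ => ?_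
        rw [Finset.sum_const, Finset.card_univ, Fintype.card_fin, nsmul_eq_mul]; ring
    _ = (d : ℝ) * (cruxC d L * ε) * (((l1Ball R : Finset (Site d))).card * ∑ z ∈ periodBox (d := d) N, ∑ κ : Fin d, ‖Φ z κ‖) := by
        rw [hmult]
    _ = (cruxC d L * ((d : ℝ) * ((l1Ball R : Finset (Site d))).card)) * ε * tl1 N ψ := by
        rw [← dirL1_extDir N ψ, ← hΦ]; unfold dirL1; ring
    _ ≤ thetaLoc d L * ε * tl1 N ψ := by
        have h := (cruxC_mul_card_le d L).1
        exact mul_le_mul_of_nonneg_right (mul_le_mul_of_nonneg_right h hε0) (tl1_nonneg N ψ)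

/-- **`K` IN ℓ²(TORUS)**: `tl2 (K ψ) ≤ (thetaLoc·ε)² · tl2 ψ`. [folklore] -/
theorem tl2_straightDefect_le (ψ : TDir d n N) :
    tl2 N (straightDefect hL k hWu hx hs hWx N ψ) ≤ (thetaLoc d L * (((L : ℝ) ^ (k + 1)) ^ 2 * x)) ^ 2 * tl2 N ψ := by
  have hN1 : 1 ≤ N := Nat.one_le_iff_ne_zero.mpr (NeZero.ne N)
  set ε : ℝ := ((L : ℝ) ^ (k + 1)) ^ 2 * x with hε
  have hε0 : 0 ≤ ε := by rw [hε]; positivity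
  set Φ : Site d → Fin d → Matrix n n ℂ := extDir N ψ with hΦ
  set R : ℕ := nbRad d L + d with hR
  set S : Site d → ℝ := fun z => ∑ t ∈ l1Ball R, ∑ κ : Fin d, ‖Φ (z + t) κ‖ ^ 2 with hS
  have hS0 : ∀ z, 0 ≤ S z := fun z => Finset.sum_nonneg fun _ _ => Finset.sum_nonneg fun _ _ => sq_nonneg _
  have hc0 : 0 ≤ cruxC d L * ε := mul_nonneg (cruxC_nonneg d L) hε0
  have hpt : ∀ (r : Fin d → Fin N) (κ : Fin d), ‖straightDefect hL k hWu hx hs hWx N ψ r κ‖ ^ 2 ≤ (cruxC d L * ε) ^ 2 * S (boxVec N r) := by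
    intro r κ
    rw [straightDefect_apply]
    have hψ : ψ r κ = Φ (boxVec N r) κ := by rw [hΦ]; unfold extDir; rw [redN_boxVec]
    rw [hψ]
    have h := norm_QbarIter_covLift_sub_le hL k hWu hx hs hWx Φ (boxVec N r) κ (s := Real.sqrt (S (boxVec N r))) (Real.sqrt_nonneg _)
      (fun z' κ' hz' => by rw [hS]; exact norm_le_locL2 Φ _ κ' hz')
    calc ‖QbarIter L (k + 1) W (covLift (L ^ (k + 1)) W Φ) (boxVec N r) κ - Φ (boxVec N r) κ‖ ^ 2
        ≤ (cruxC d L * ε * Real.sqrt (S (boxVec N r))) ^ 2 := pow_le_pow_left₀ (norm_nonneg _) h 2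
      _ = (cruxC d L * ε) ^ 2 * S (boxVec N r) := by rw [mul_pow, Real.sq_sqrt (hS0 _)]
  have hper : ∀ (z : Site d) (τ : Fin d), (∑ κ : Fin d, ‖Φ (z + (N : ℤ) • e τ) κ‖ ^ 2) = ∑ κ : Fin d, ‖Φ z κ‖ ^ 2 := by
    intro z τ
    simp only [hΦ, AveragingDeficitTorusChart.extDir_add_smul]
  have hmult : ∑ z ∈ periodBox (d := d) N, S z = ((l1Ball R : Finset (Site d))).card * ∑ z ∈ periodBox (d := d) N, ∑ κ : Fin d, ‖Φ z κ‖ ^ 2 := by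
    have key := sum_periodBox_sum_l1Ball (g := fun w => ∑ κ : Fin d, ‖Φ w κ‖ ^ 2) hN1 hper R
    beta_reduce at key
    rw [hS]; beta_reduce; exact key
  have hε2 : (thetaLoc d L * ε) ^ 2 = thetaLoc d L ^ 2 * ε ^ 2 := mul_pow _ _ _
  calc tl2 N (straightDefect hL k hWu hx hs hWx N ψ)
      ≤ ∑ r : Fin d → Fin N, ∑ _κ : Fin d, (cruxC d L * ε) ^ 2 * S (boxVec N r) := Finset.sum_le_sum fun r _ => Finset.sum_le_sum fun κ _ => hpt r κ
    _ = (d : ℝ) * (cruxC d L * ε) ^ 2 * ∑ z ∈ periodBox (d := d) N, S z := by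
        rw [← sum_univ_boxVec, Finset.mul_sum]
        refine Finset.sum_congr rfl fun r _ => ?_
        rw [Finset.sum_const, Finset.card_univ, Fintype.card_fin, nsmul_eq_mul]; ring
    _ = (d : ℝ) * (cruxC d L * ε) ^ 2 * (((l1Ball R : Finset (Site d))).card * ∑ z ∈ periodBox (d := d) N, ∑ κ : Fin d, ‖Φ z κ‖ ^ 2) := by
        rw [hmult]
    _ = (cruxC d L ^ 2 * ((d : ℝ) * ((l1Ball R : Finset (Site d))).card)) * ε ^ 2 * tl2 N ψ := by
        rw [← dirSq_extDir N ψ, ← hΦ]; unfold dirSq; ring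
    _ ≤ (thetaLoc d L * ε) ^ 2 * tl2 N ψ := by
        have h := (cruxC_mul_card_le d L).2
        rw [hε2]
        exact mul_le_mul_of_nonneg_right (mul_le_mul_of_nonneg_right h (sq_nonneg _)) (tl2_nonneg N ψ)

/-! ## §4 The three solve letters -/

/-- The restricted operator, coerced: `↑(K|_skew ψ) = K ↑ψ`. [folklore] -/
theorem coe_straightDefectSkew (ψ : ↥(skewSub d n N)) :
    ((straightDefectSkew hL k hWu hx hs hWx N ψ : ↥(skewSub d n N)) : TDir d n N) = straightDefect hL k hWu hx hs hWx N (ψ : TDir d n N) := rfl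

/-- The solve identity on the torus, pointwise: `ψ = ρ − Kψ` for `ψ = solveW ρ`. [folklore] -/
theorem solveW_apply_eq (hθ : cruxC d L * (((L : ℝ) ^ (k + 1)) ^ 2 * x) < 1) (ρ : ↥(skewSub d n N)) (r : Fin d → Fin N) (κ : Fin d) :
    ((solveW hL k hWu hx hs hWx N hθ ρ : ↥(skewSub d n N)) : TDir d n N) r κ
      = (ρ : TDir d n N) r κ - straightDefect hL k hWu hx hs hWx N ((solveW hL k hWu hx hs hWx N hθ ρ : ↥(skewSub d n N)) : TDir d n N) r κ := by
  have h := congrArg (fun v : ↥(skewSub d n N) => ((v : TDir d n N) r κ)) (solveW_eq hL k hWu hx hs hWx N hθ ρ)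
  simp only [Submodule.coe_add, Pi.add_apply, coe_straightDefectSkew] at h
  rw [← h, add_sub_cancel_right]

/-- **THE ℓ¹ SOLVE LETTER ON THE TORUS**: `tl1 (solveW ρ) ≤ tl1 ρ ∕ (1 − thetaLoc·ε)`. [folklore] -/
theorem tl1_solveW_le (hθ : cruxC d L * (((L : ℝ) ^ (k + 1)) ^ 2 * x) < 1) (hθl : thetaLoc d L * (((L : ℝ) ^ (k + 1)) ^ 2 * x) < 1)
    (ρ : ↥(skewSub d n N)) :
    tl1 N ((solveW hL k hWu hx hs hWx N hθ ρ : ↥(skewSub d n N)) : TDir d n N) ≤ tl1 N (ρ : TDir d n N) / (1 - thetaLoc d L * (((L : ℝ) ^ (k + 1)) ^ 2 * x)) := by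
  set ψ : TDir d n N := ((solveW hL k hWu hx hs hWx N hθ ρ : ↥(skewSub d n N)) : TDir d n N) with hψ
  have hK := tl1_straightDefect_le hL k hWu hx hs hWx N ψ
  have htri : tl1 N ψ ≤ tl1 N (ρ : TDir d n N) + tl1 N (straightDefect hL k hWu hx hs hWx N ψ) := by
    unfold tl1
    rw [← Finset.sum_add_distrib]
    refine Finset.sum_le_sum fun r _ => ?_
    rw [← Finset.sum_add_distrib]
    refine Finset.sum_le_sum fun κ _ => ?_
    rw [hψ, solveW_apply_eq hL k hWu hx hs hWx N hθ ρ r κ]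
    exact norm_sub_le _ _
  rw [le_div_iff₀ (by linarith)]
  nlinarith [tl1_nonneg N ψ]

/-- **THE ℓ² SOLVE LETTER ON THE TORUS**: `tl2 (solveW ρ) ≤ tl2 ρ ∕ (1 − thetaLoc·ε)²` (Minkowski). [folklore] -/
theorem tl2_solveW_le (hθ : cruxC d L * (((L : ℝ) ^ (k + 1)) ^ 2 * x) < 1) (hθl : thetaLoc d L * (((L : ℝ) ^ (k + 1)) ^ 2 * x) < 1)
    (ρ : ↥(skewSub d n N)) :
    tl2 N ((solveW hL k hWu hx hs hWx N hθ ρ : ↥(skewSub d n N)) : TDir d n N)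
      ≤ tl2 N (ρ : TDir d n N) / (1 - thetaLoc d L * (((L : ℝ) ^ (k + 1)) ^ 2 * x)) ^ 2 := by
  obtain ⟨θl, hθldef⟩ : ∃ θ' : ℝ, θ' = thetaLoc d L * (((L : ℝ) ^ (k + 1)) ^ 2 * x) := ⟨_, rfl⟩
  rw [← hθldef] at hθl ⊢
  have hθl0 : 0 ≤ θl := by
    rw [hθldef]; exact mul_nonneg (thetaLoc_nonneg d L) (mul_nonneg (pow_nonneg (pow_nonneg (Nat.cast_nonneg L) _) 2) hx)
  obtain ⟨ψ, hψ⟩ : ∃ ψ' : TDir d n N, ψ' = ((solveW hL k hWu hx hs hWx N hθ ρ : ↥(skewSub d n N)) : TDir d n N) := ⟨_, rfl⟩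
  rw [← hψ]
  obtain ⟨Kψ, hKψ⟩ : ∃ K' : TDir d n N, K' = straightDefect hL k hWu hx hs hWx N ψ := ⟨_, rfl⟩
  have hK : tl2 N Kψ ≤ θl ^ 2 * tl2 N ψ := by rw [hKψ, hθldef]; exact tl2_straightDefect_le hL k hWu hx hs hWx N ψ
  -- Minkowski on the period box: `ext ψ = ext ρ + (−ext Kψ)`
  have hdec : extDir N ψ = fun z κ => extDir N (ρ : TDir d n N) z κ + (fun w μ => -extDir N Kψ w μ) z κ := by
    funext z κ
    show ψ (redN N z) κ = (ρ : TDir d n N) (redN N z) κ + -(Kψ (redN N z) κ)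
    rw [hKψ, hψ, solveW_apply_eq hL k hWu hx hs hWx N hθ ρ, sub_eq_add_neg]
  have hsum : l2sq (periodBox (d := d) N) (fun z κ => extDir N (ρ : TDir d n N) z κ + (fun w μ => -extDir N Kψ w μ) z κ) = tl2 N ψ := by
    rw [← l2sq_extDir N ψ, hdec]
  have hneg : l2sq (periodBox (d := d) N) (fun w μ => -extDir N Kψ w μ) = tl2 N Kψ := by
    rw [← l2sq_extDir N Kψ]; simp only [l2sq, norm_neg]
  have hmink : Real.sqrt (tl2 N ψ) ≤ Real.sqrt (tl2 N (ρ : TDir d n N)) + Real.sqrt (tl2 N Kψ) := by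
    have h := sqrt_l2sq_add_le (periodBox (d := d) N) (extDir N (ρ : TDir d n N)) (fun w μ => -extDir N Kψ w μ)
    rw [hsum, hneg, l2sq_extDir] at h
    exact h
  -- `√tl2 Kψ ≤ θl·√tl2 ψ`, hence `√tl2 ψ·(1 − θl) ≤ √tl2 ρ`
  have hKs : Real.sqrt (tl2 N Kψ) ≤ θl * Real.sqrt (tl2 N ψ) := by
    rw [← Real.sqrt_sq hθl0, ← Real.sqrt_mul (sq_nonneg _)]
    exact Real.sqrt_le_sqrt hK
  have hroot : Real.sqrt (tl2 N ψ) * (1 - θl) ≤ Real.sqrt (tl2 N (ρ : TDir d n N)) := by linarith [hmink, hKs]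
  have h1 : 0 < 1 - θl := by linarith
  have hroot' : Real.sqrt (tl2 N ψ) ≤ Real.sqrt (tl2 N (ρ : TDir d n N)) / (1 - θl) := by rw [le_div_iff₀ h1]; exact hroot
  calc tl2 N ψ = Real.sqrt (tl2 N ψ) ^ 2 := (Real.sq_sqrt (tl2_nonneg N ψ)).symm
    _ ≤ (Real.sqrt (tl2 N (ρ : TDir d n N)) / (1 - θl)) ^ 2 := pow_le_pow_left₀ (Real.sqrt_nonneg _) hroot' 2
    _ = tl2 N (ρ : TDir d n N) / (1 - θl) ^ 2 := by rw [div_pow, Real.sq_sqrt (tl2_nonneg N _)]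

/-- **THE ℓ¹ SOLVE LETTER** (period-box currency): with `Φ := ext((1+K)⁻¹(res φ))`,
`dirL1 Φ (periodBox N) ≤ dirL1 φ (periodBox N) ∕ (1 − thetaLoc·(L^{k+1})²·x)`. [folklore] -/
theorem dirL1_solve_le (hθ : cruxC d L * (((L : ℝ) ^ (k + 1)) ^ 2 * x) < 1) (hθl : thetaLoc d L * (((L : ℝ) ^ (k + 1)) ^ 2 * x) < 1)
    {φ : Site d → Fin d → Matrix n n ℂ} (hφ : IsSkewDir φ) :
    dirL1 (extDir N ((solveW hL k hWu hx hs hWx N hθ (resSkew N hφ) : ↥(skewSub d n N)) : TDir d n N)) (periodBox (d := d) N)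
      ≤ dirL1 φ (periodBox (d := d) N) / (1 - thetaLoc d L * (((L : ℝ) ^ (k + 1)) ^ 2 * x)) := by
  rw [dirL1_extDir, dirL1_periodBox_eq_tl1, ← coe_resSkew N hφ]
  exact tl1_solveW_le hL k hWu hx hs hWx N hθ hθl _

/-- **THE ℓ² SOLVE LETTER** (period-box currency): `dirSq Φ (periodBox N) ≤ dirSq φ (periodBox N) ∕ (1 − thetaLoc·(L^{k+1})²·x)²`. [folklore] -/
theorem dirSq_solve_le (hθ : cruxC d L * (((L : ℝ) ^ (k + 1)) ^ 2 * x) < 1) (hθl : thetaLoc d L * (((L : ℝ) ^ (k + 1)) ^ 2 * x) < 1)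
    {φ : Site d → Fin d → Matrix n n ℂ} (hφ : IsSkewDir φ) :
    dirSq (extDir N ((solveW hL k hWu hx hs hWx N hθ (resSkew N hφ) : ↥(skewSub d n N)) : TDir d n N)) (periodBox (d := d) N)
      ≤ dirSq φ (periodBox (d := d) N) / (1 - thetaLoc d L * (((L : ℝ) ^ (k + 1)) ^ 2 * x)) ^ 2 := by
  rw [dirSq_extDir, dirSq_periodBox_eq_tl2, ← coe_resSkew N hφ]
  exact tl2_solveW_le hL k hWu hx hs hWx N hθ hθl _

/-- **THE SUP SOLVE LETTER** (bond currency; W5's `norm_solveW_le` unpacked): `‖Φ z κ‖ ≤ s ∕ (1 − cruxC·(L^{k+1})²·x)` for `‖φ‖_∞ ≤ s`. [folklore] -/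
theorem norm_solve_le (hθ : cruxC d L * (((L : ℝ) ^ (k + 1)) ^ 2 * x) < 1) {φ : Site d → Fin d → Matrix n n ℂ} (hφ : IsSkewDir φ)
    {s : ℝ} (hs0 : 0 ≤ s) (hφs : ∀ (z : Site d) (κ : Fin d), ‖φ z κ‖ ≤ s) (z : Site d) (κ : Fin d) :
    ‖extDir N ((solveW hL k hWu hx hs hWx N hθ (resSkew N hφ) : ↥(skewSub d n N)) : TDir d n N) z κ‖
      ≤ s / (1 - cruxC d L * (((L : ℝ) ^ (k + 1)) ^ 2 * x)) := by
  set ψ : ↥(skewSub d n N) := solveW hL k hWu hx hs hWx N hθ (resSkew N hφ) with hψ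
  have hρ : ‖(resSkew N hφ : ↥(skewSub d n N))‖ ≤ s := by
    show ‖(resDir N φ : TDir d n N)‖ ≤ s
    exact (pi_norm_le_iff_of_nonneg hs0).mpr fun r => (pi_norm_le_iff_of_nonneg hs0).mpr fun κ => hφs _ _
  have h1 : 0 < 1 - cruxC d L * (((L : ℝ) ^ (k + 1)) ^ 2 * x) := by linarith
  have hψn : ‖ψ‖ ≤ s / (1 - cruxC d L * (((L : ℝ) ^ (k + 1)) ^ 2 * x)) :=
    (norm_solveW_le hL k hWu hx hs hWx N hθ _).trans (div_le_div_of_nonneg_right hρ h1.le)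
  exact ((norm_le_pi_norm ((ψ : TDir d n N) (redN N z)) κ).trans (norm_le_pi_norm (ψ : TDir d n N) (redN N z))).trans hψn

end Operator

end

end Summit.QuantumFields.BalabanUV.T4Continuum.NE3RightInverseSolveLetters
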